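import Summits.HubbardSuperconductivity.HubbardSuperconductivity.Theorems.AnisotropyChordTransferOneLink
import Summits.HubbardSuperconductivity.HubbardSuperconductivity.Theorems.AnisotropyChordTowerLowestWeight
import Summits.HubbardSuperconductivity.HubbardSuperconductivity.Theorems.AnisotropyChordTotalSpinNearFMProof
import Summits.HubbardSuperconductivity.HubbardSuperconductivity.Theorems.AnisotropyChordTowerPerronZero

/-!
# Route `AnisotropyChord` / H0 rotor rung, route (1): SECTOR BOOKKEEPING for THEOREM T
(prover seat `hubbard-h0-rotor-p1` g13; theory seat `hubbard-h0-rotor-theory-1` THEOREM-T.md)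

Existence of Perron sector ground amplitudes in every integer sector `i` (`|i| ≤ L²/2`) once the sector `0` carries one
(`exists_perron_of_weight`, `exists_perron_nat`, `exists_perron_neg_one`), and the per-sector identities/bounds used by the
induction of THEOREM T: `‖S⁺a‖² = ⟨S⃗²⟩ − M² − M`, `‖S⁻a‖² = ⟨S⃗²⟩ − M² + M`, `⟨S⃗²⟩ ≤ S(S+1)`, and the variational floors
`E(M±1)‖S^±a‖² ≤ ⟨S^±a, H S^±a⟩`.
-/

set_option linter.dupNamespace false
set_option autoImplicit false

noncomputable section

open Finset Filter Topology
open Literature.MathematicalPhysics.QuantumLattice Literature.Probability.LatticeModels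
open Summit.HubbardSuperconductivity.HubbardSuperconductivity.Theorems.AnisotropyChord.InsertionEntropy
open Summit.HubbardSuperconductivity.HubbardSuperconductivity.Theorems.AnisotropyChord.Tower
open Summit.HubbardSuperconductivity.HubbardSuperconductivity.Theorems.AnisotropyChord

namespace Summit.HubbardSuperconductivity.HubbardSuperconductivity.Theorems.AnisotropyChord.Transfer

variable {L : ℕ} [NeZero L]

/-! ## Existence of Perron amplitudes in the integer sectors -/

/-- a Perron amplitude exists in the sector of weight `W ≤ L²`. [folklore] -/
theorem exists_perron_of_weight (Δ : ℝ) (W : ℕ) (hW : W ≤ L ^ 2) :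
    ∃ b : TensorIndex (TorusSite 2 L) 2 → ℝ,
      IsPerronSectorGroundAmplitude L Δ (((Fintype.card (TorusSite 2 L) * 1 : ℕ) : ℝ) / 2 - (W : ℝ)) b := by
  apply exists_perronAmplitude
  obtain ⟨σ₀, hσ₀⟩ :=
    Summit.AtomisticToContinuum.BoseEinsteinCondensation.Theorems.BECStronglyRayleighSectorPerron.exists_config_weight_eq
      2 L W hW
  intro hbot
  set φ : TensorIndex (TorusSite 2 L) 2 → ℂ := fun s => if s = σ₀ then 1 else 0 with hφ
  have hφK : φ ∈ spinZSector (Λ := TorusSite 2 L) 1 (((Fintype.card (TorusSite 2 L) * 1 : ℕ) : ℝ) / 2 - (W : ℝ)) := by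
    refine (LiebMattis.mem_spinZSector_weight_iff 1 W φ).2 fun s hs => ?_
    have hsσ : s ≠ σ₀ := by rintro rfl; exact hs hσ₀
    simp [hφ, hsσ]
  rw [hbot, Submodule.mem_bot] at hφK
  have := congrFun hφK σ₀
  simp [hφ] at this

/-- the half-filling particle number `n₀ = L²/2` of a Perron amplitude in the sector `0`. [folklore] -/
theorem exists_half_of_perron_zero {Δ : ℝ} {a₀ : TensorIndex (TorusSite 2 L) 2 → ℝ}
    (ha₀ : IsPerronSectorGroundAmplitude L Δ 0 a₀) :
    ∃ n₀ : ℕ, 2 * n₀ = L ^ 2 ∧ (n₀ : ℝ) = (Fintype.card (TorusSite 2 L) : ℝ) / 2 := by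
  obtain ⟨n, _, hn⟩ := perron_natSector ha₀
  have hcard : Fintype.card (TorusSite 2 L) = L ^ 2 := by
    rw [Fintype.card_fun, ZMod.card, Fintype.card_fin]
  refine ⟨n, ?_, by rw [hn]; ring⟩
  have h : (2 * n : ℝ) = ((L ^ 2 : ℕ) : ℝ) := by rw [← hcard]; linarith
  exact_mod_cast h

/-- Perron amplitudes in every integer sector `i` with `n₀ − W`-bookkeeping: sector `(card)/2 − (n₀ − i) = i` for `i ≤ n₀`
and sector `−1 = card/2 − (n₀ + 1)`. [folklore] -/
theorem exists_perron_nat {Δ : ℝ} {a₀ : TensorIndex (TorusSite 2 L) 2 → ℝ}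
    (ha₀ : IsPerronSectorGroundAmplitude L Δ 0 a₀) (i : ℕ) (hi : 2 * i ≤ L ^ 2) :
    ∃ b : TensorIndex (TorusSite 2 L) 2 → ℝ, IsPerronSectorGroundAmplitude L Δ (i : ℝ) b := by
  obtain ⟨n₀, hn₀, hn₀r⟩ := exists_half_of_perron_zero ha₀
  have hin : i ≤ n₀ := by omega
  obtain ⟨b, hb⟩ := exists_perron_of_weight (L := L) Δ (n₀ - i) (by omega)
  have e : (((Fintype.card (TorusSite 2 L) * 1 : ℕ) : ℝ) / 2 - ((n₀ - i : ℕ) : ℝ)) = (i : ℝ) := by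
    rw [Nat.cast_sub hin, mul_one, ← hn₀r]; ring
  rw [e] at hb
  exact ⟨b, hb⟩

/-- … and in the sector `−1`. [folklore] -/
theorem exists_perron_neg_one {Δ : ℝ} {a₀ : TensorIndex (TorusSite 2 L) 2 → ℝ}
    (ha₀ : IsPerronSectorGroundAmplitude L Δ 0 a₀) (hL : 2 ≤ L ^ 2) :
    ∃ b : TensorIndex (TorusSite 2 L) 2 → ℝ, IsPerronSectorGroundAmplitude L Δ (-1) b := by
  obtain ⟨n₀, hn₀, hn₀r⟩ := exists_half_of_perron_zero ha₀
  obtain ⟨b, hb⟩ := exists_perron_of_weight (L := L) Δ (n₀ + 1) (by omega)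
  have e : (((Fintype.card (TorusSite 2 L) * 1 : ℕ) : ℝ) / 2 - ((n₀ + 1 : ℕ) : ℝ)) = (-1 : ℝ) := by
    rw [mul_one, ← hn₀r]; push_cast; ring
  rw [e] at hb
  exact ⟨b, hb⟩

/-! ## Per-sector bookkeeping of a Perron amplitude -/

/-- `‖S⁺a‖² = ⟨S⃗²⟩_a − M² − M` for a Perron amplitude of sector `M`. [folklore] -/
theorem raiseNormSq_eq_totalSpinSq {Δ M : ℝ} {a : TensorIndex (TorusSite 2 L) 2 → ℝ}
    (ha : IsPerronSectorGroundAmplitude L Δ M a) :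
    raiseNormSq a = Summit.HubbardSuperconductivity.HubbardSuperconductivity.Theorems.AnisotropyChord.Tower.totalSpinSq a M
      - M ^ 2 - M := by
  have h := raiseNormSq_eq_lowerNormSq_add a ((Fintype.card (TorusSite 2 L) : ℝ) / 2 + M)
    (fun ν hν => by have := perron_support ha ν hν; unfold zerosCard at this; exact this)
  rw [ha.unit, mul_one] at h
  unfold Summit.HubbardSuperconductivity.HubbardSuperconductivity.Theorems.AnisotropyChord.Tower.totalSpinSq
  rw [h]; ring

/-- `‖S⁻a‖² = ⟨S⃗²⟩_a − M² + M`. [folklore] -/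
theorem lowerNormSq_eq_totalSpinSq (M : ℝ) (a : TensorIndex (TorusSite 2 L) 2 → ℝ) :
    lowerNormSq a = Summit.HubbardSuperconductivity.HubbardSuperconductivity.Theorems.AnisotropyChord.Tower.totalSpinSq a M
      - M ^ 2 + M := by
  unfold Summit.HubbardSuperconductivity.HubbardSuperconductivity.Theorems.AnisotropyChord.Tower.totalSpinSq; ring

/-- `⟨S⃗²⟩_a ≤ S(S+1)`, `S = |V|/2`. [folklore] -/
theorem totalSpinSq_le_top {Δ M : ℝ} {a : TensorIndex (TorusSite 2 L) 2 → ℝ} (ha : IsPerronSectorGroundAmplitude L Δ M a) :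
    Summit.HubbardSuperconductivity.HubbardSuperconductivity.Theorems.AnisotropyChord.Tower.totalSpinSq a M
      ≤ ((Fintype.card (TorusSite 2 L) : ℝ) / 2) * ((Fintype.card (TorusSite 2 L) : ℝ) / 2 + 1) := by
  rw [perron_totalSpinSq ha]
  have := inner_fmOp_nonneg (⊤ : SimpleGraph (TorusSite 2 L)) a
  linarith

/-- variational floor for `S⁺a`: `E(M+1)‖S⁺a‖² ≤ ⟨S⁺a, H S⁺a⟩`. [folklore] -/
theorem sectorE_succ_mul_le {Δ M : ℝ} {a : TensorIndex (TorusSite 2 L) 2 → ℝ} (ha : IsPerronSectorGroundAmplitude L Δ M a) :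
    sectorE L Δ (M + 1) * raiseNormSq a ≤ energyQ L Δ (raiseSum a) :=
  sectorE_mul_le_energyQ Δ (M + 1) (raiseSum a) (raiseSum_support_perron ha)

/-- variational floor for `S⁻a`: `E(M−1)‖S⁻a‖² ≤ ⟨S⁻a, H S⁻a⟩`. [folklore] -/
theorem sectorE_pred_mul_le {Δ M : ℝ} {a : TensorIndex (TorusSite 2 L) 2 → ℝ} (ha : IsPerronSectorGroundAmplitude L Δ M a) :
    sectorE L Δ (M - 1) * lowerNormSq a ≤ energyQ L Δ (lowerSum a) := by
  apply sectorE_mul_le_energyQ Δ (M - 1) (lowerSum a)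
  intro τ hτ
  have h := lowerSum_support' a ((Fintype.card (TorusSite 2 L) : ℝ) / 2 + M) (fun ν hν => perron_support ha ν hν) τ hτ
  rw [h]; ring


end Summit.HubbardSuperconductivity.HubbardSuperconductivity.Theorems.AnisotropyChord.Transfer
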